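import Summits.Ventures.PercRepro.SixFourPLJlow
import Summits.Ventures.PercRepro.SixFourPLCost
import Summits.Ventures.PercRepro.SixFourPLLpp
import Summits.Ventures.PercRepro.SixFourPLTrace

/-!
# PercRepro — C-025 at `(6,4)`: THEOREM 22.12, `SixTwoSix` and Theorem 22 UNCONDITIONAL (p3, gen 10)

The four steps of mine-2's Theorem 22.12 (`MINE2-RLS.md` §22.12.4) are in the kernel — (1) the cost bound
`cost_profile_le` (`SixFourPLCost`), (2) the bonus bound `bonus5sum_profile_le` (`SixFourPLBonus`), (3) the lpp bound
`lpp_profile_le` (`SixFourPLLpp`), (4) the covering-pair bound `Xcnt_le_Xbar_profile` (`SixFourPLTrace`, mine-2's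
seam) — and the identity 22.1 is `J_four_identity`.  Substituting gives

* **`J15_profile_le`**: `15·Jlow(π(G)) ≤ 15·J₄(G)` for every normalisation `D` of a plane-line set (Theorem 22.12);
* **`plJlow_holds : PLJlow`**, hence **`sixTwoSix_holds : SixTwoSix`** — in every universe, directly from
  `exists_PLData`, `profile_mem_LIST` and the finite check `LIST_pos` — i.e. mine-2's §22.6: every non-generic
  rank-`4` set `G ⊆ E` of a simple matroid with `10 ≤ g ≤ 14` points and plane traces `≤ 7` has `J₄(G) > 0`;
* **`J_four_nonneg_of_ten_le`**: THEOREM 22 with no hypothesis left — `0 ≤ J₄(G)` for every rank-`4` set `G ⊆ E` of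
  a simple matroid with `g ≥ 10` points and plane traces `≤ 7` (`J_four_nonneg_of_sixTwoSix` applied).
-/

namespace PercRepro.SixFour

open Finset ThmH

universe u

variable {α : Type*} [DecidableEq α] {M : Matroid α} [M.Finite] {G : Finset α}

/-- `F5(g) = 5·F(g)`. -/
theorem F5_eq (g : ℕ) : (PL.F5 g : ℚ) = 5 * Fg g := by
  unfold PL.F5 Fg S3
  simp only [PLch_eq_choose]
  push_cast
  ring

namespace PLData

variable {D : PLData M G}

/-- **Theorem 22.12**: `15·Jlow(π) ≤ 15·J₄(G)` for every normalisation `D` of a plane-line set (`simple M`,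
`G ⊆ E` of rank `4`, plane traces `≤ 7`, `10 ≤ g`). -/
theorem J15_profile_le (hs : Simple M) (hG : G ⊆ gr M) (hr : M.eRk (G : Set α) = 4)
    (hpl : ∀ P ∈ planes M, (P ∩ G).card ≤ 7) (hg : 10 ≤ G.card) : (PL.J15 D.profile : ℚ) ≤ 15 * J M G 4 := by
  obtain ⟨hne, -, hp7, hn3, -⟩ := size_facts (D := D) hs hG hpl hg
  have h2 : 2 ≤ D.L.card := by omega
  have hid := J_four_identity hs hG hr
  have hcost := cost_profile_le (D := D) hs hG hpl hg
  have hbonus := bonus5sum_profile_le (D := D) hs hG h2 hne hn3 hp7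
  have hlpp := lpp_profile_le (D := D) hs hG hpl hg
  have hX : (Xcnt M G : ℚ) ≤ (PL.Xbar D.profile : ℚ) := by
    exact_mod_cast Xcnt_le_Xbar_profile (D := D) hs hG hr hpl hg
  have hF : (PL.F5 (PL.g D.profile) : ℚ) = 5 * Fg G.card := by
    rw [g_profile]
    exact F5_eq _
  unfold PL.J15
  push_cast
  rw [hid]
  linarith

end PLData

/-- **`PLJlow` holds** (Theorem 22.12 in the form of `SixFourPLJlow.lean`). -/
theorem plJlow_holds : PLJlow := by
  intro β _ M _ G hs hG hr hpl hg D
  exact D.J15_profile_le hs hG hr hpl hg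

/-- **`SixTwoSix` holds in every universe** (mine-2's §22.6, the plane-line case of Theorem 22): a non-generic
rank-`4` set has a normalisation `D`, whose profile is in `LIST` with `15·Jlow > 0`, and `15·Jlow ≤ 15·J₄`. -/
theorem sixTwoSix_holds : SixTwoSix.{u} := by
  intro β _ M _ G hs hG hr hgen hpl hg _
  obtain ⟨D, -⟩ := exists_PLData hs hG hr hgen
  have hle := D.J15_profile_le hs hG hr hpl hg
  have hpos : (0 : ℚ) < PL.J15 D.profile := by
    exact_mod_cast PL.J15_pos_of_mem (D.profile_mem_LIST hs hG hpl hg)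
  linarith

/-- **THEOREM 22 (unconditional)**: for every simple matroid `M` and every rank-`4` set `G ⊆ E` with at least `10`
points and plane traces of at most `7` points, `0 ≤ J₄(G)`. -/
theorem J_four_nonneg_of_ten_le {β : Type u} [DecidableEq β] {M : Matroid β} [M.Finite] {G : Finset β}
    (hs : Simple M) (hG : G ⊆ gr M) (hr : M.eRk (G : Set β) = 4) (hpl : ∀ P ∈ planes M, (P ∩ G).card ≤ 7)
    (hg : 10 ≤ G.card) : 0 ≤ J M G 4 :=
  J_four_nonneg_of_sixTwoSix sixTwoSix_holds.{u} hs hG hr hpl hg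

end PercRepro.SixFour
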